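import Summits.BirchSwinnertonDyer.BirchSwinnertonDyer.Theorems.ByReductionTypeAtTwoSupersingularThetaHabitatKatoBothSidesKit
import Summits.BirchSwinnertonDyer.BirchSwinnertonDyer.Theorems.ByReductionTypeAtTwoSupersingularThetaClass184041bk
import HarnessLib

/-!
# Crux `SupersingularRankZeroAtTwo` (item stmt-BirchSwinnertonDyer-19097): CLASS DISPLAY `184041bk` on the «Kato on both sides» theta
# road — `BSD(184041bk1, 2)` from Kato-side inputs at `E = 184041bk1` and at its rank-`0` CM partner `A = cmA1089a` (`d = 3`), TP2's transport
# K1 by name, Burungale–Flach's BSD₂(A); NO Eisenstein-side input on either curve (seat `bsd-2adic-ss-1x` GEN 3)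

HONEST FRAMING (cells `bsd-2adic` and `bsd-wall`; HUMAN RULINGS D-0036/D-0054/D-0074): THEOREM ONLY — no definition, no named
fact, no instance, no `sorry`; nothing about the curves is asserted beyond the displayed binders; closes nothing by itself; BSD
is NOT proved by any of this. PARTITION (D-0054): X5@2 good-ss, `a₂ = 0` THETA-HABITAT sub-row (class `184041bk`, `N_E = 184041`,
partner `cmA1089a`, `N_A = 1089`) × `p = 2` — types-the-object-of; bears_on: K4-leaf crux 19097 · TP2 K1 20333 (by name).

DISPLAY `SSThetaRoad.bsdp_two_184041bk1_of_katoBothSides`: PUB {`hmod` modularity, `hGZK`, Kato `h124`/`hX0` (Thm. 12.4 (2), 12.4 (1)∘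
(17.13.1)), `hBF` Burungale–Flach, `h2` = `realPeriodRat_eq_unit_mul_plusPeriod_two`} · TP2 ITEM {K1 `hT` `SignedTransportAtTwo`} ·
research binders AT `E`: (2′) `hEC` (signed Γ-Euler characteristic at `2`), (4)ʳᵃᵗ `hCK` (rational Coleman–Kato package at `2`);
AT `A`: (T2) `hT2A` (torsion of `X⁺(A/ℚ_∞)`), (μ) `hmuA` (`μ⁺(A) = 0`), (K4c) `hKimA` (Kim's control term at `2`), (4)ʳᵃᵗ `hCKA` ·
CERT {`L(E,1) ≠ 0` (Cremona), `L(A,1) ≠ 0` (= 1.58872, Cremona allbsd)}. KERNEL (imported from the sibling class file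
`…SupersingularThetaClass184041bk` p532407 and its imports): `E` non-CM, good supersingular at `2` with `a₂ = 0`, globally minimal;
`A` CM, good supersingular at `2` with `a₂ = 0`, globally minimal; `E[2] ≅ A[2]` by the Tschirnhaus certificate
(`tschirnhaus_root_184041bk1` / `tschirnhaus_inv_184041bk1`). ABSENT: stub (3) `KobayashiLowerDivisibility W 2 1`, K2r0's (E_A)
`KobayashiLowerDivisibility A 2 1`, stub (4′), every `TwoAdicSurjective` guard. Door: `SSThetaRoad.bsdp_two_baseChange_int_of_katoBothSides_at`.

References: [Kobayashi2003] Thm. 1.2, 4.1; [Kato2004Asterisque] Thm. 12.4–12.5 (3), §15; [BDKim2013] Cor. 3.15; [BurungaleFlach2024]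
Thm. 1.1 / Cor. 2; [GreenbergVatsal2000] Thm. (1.4); [AbbesUllmo1996] Thm. A; [CremonaAlgorithms1997] Table 1; [Miller2011LMS] Def. 1.1;
HABITAT-CENSUS-TP2-v1.md / v1.1; INDEX-THETA-19.tsv (bsd-2adic/ss1x/theta).
-/

set_option autoImplicit false
-- the Theorems namespace of this sub repeats the summit name by design (D-0017 nested layout)
set_option linter.dupNamespace false

noncomputable section

open scoped Classical Polynomial

open CongruenceSubgroup WeierstrassCurve Literature.NumberTheory.EllipticCurves
  Literature.NumberTheory.EllipticCurves.ModularForms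
  Literature.NumberTheory.EllipticCurves.Rank1Residual Literature.NumberTheory.EllipticCurves.Rank1Residual.Typed
  Literature.NumberTheory.EllipticCurves.Kobayashi2003 Literature.NumberTheory.EllipticCurves.IwasawaDual
  ZpExtension Summit.BirchSwinnertonDyer.Rank1Residual Summit.BirchSwinnertonDyer.Rank1Residual.Supersingular
  Summit.BirchSwinnertonDyer.Rank1Residual.X5 Summit.BirchSwinnertonDyer.Rank1Residual.X5.O1
  Summit.BirchSwinnertonDyer.Rank1Residual.X5.Instances
  Summit.BirchSwinnertonDyer.BirchSwinnertonDyer.Theses.ThetaPartnerAtTwo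

namespace Summit.BirchSwinnertonDyer.BirchSwinnertonDyer.Theorems
namespace SSThetaRoad

/-- **`BSD(184041bk1, 2)` ON THE «KATO ON BOTH SIDES» THETA ROAD** — class instance of crux `SupersingularRankZeroAtTwo` at the habitat
class `184041bk` (partner `cmA1089a`, `d = 3`). Displayed: PUB {`hmod`, `hGZK`, `h124`, `hX0`, `hBF`, `h2`}; TP2 ITEM {K1 `hT`}; research
binders AT `E`: (2′) `hEC`, (4)ʳᵃᵗ `hCK`; AT `A`: (T2) `hT2A`, (μ) `hmuA`, (K4c) `hKimA`, (4)ʳᵃᵗ `hCKA`; CERT {`L(E,1) ≠ 0`,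
`L(A,1) ≠ 0`}. KERNEL: `E`, `A` data and `E[2] ≅ A[2]` as in the sibling class file. No Eisenstein-side input. Closes nothing by itself.
[cite: BurungaleFlach2024, Thm. 1.1 and Cor. 2] [cite: GreenbergVatsal2000, Thm. (1.4)] [cite: Kobayashi2003, Thm. 1.2 and Thm. 4.1]
[cite: BDKim2013, Cor. 3.15] [cite: CremonaAlgorithms1997, Table 1] [cite: Miller2011LMS, Def. 1.1] -/
theorem bsdp_two_184041bk1_of_katoBothSides
    (hmod : nonempty_modularParametrizationData) (hGZK : rank_eq_analyticRank_of_analyticRank_le_one)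
    (h124 : Kato2004.thm12_4) (hX0 : Kato2004_fineSelmerDual_isTorsion)
    (hBF : bsdTriple_of_hasCM_of_L_one_ne_zero) (h2 : realPeriodRat_eq_unit_mul_plusPeriod_two)
    (hT : SignedTransportAtTwo)
    (hEC : letI := SSColemanRoad.isElliptic_184041bk1
      ∀ (κ : ZpExtension ℚ 2) (γ : Field.absoluteGaloisGroup ℚ),
          κ.IsCyclotomic → κ.IsTopGenerator γ → Finite (((⟨0, 0, 1, -36440118, -92277007144⟩ : WeierstrassCurve ℤ).baseChange ℚ).selmerGroupPInfty 2) →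
          Finite (endInvariants (conjSignedSelmerInfty ((⟨0, 0, 1, -36440118, -92277007144⟩ : WeierstrassCurve ℤ).baseChange ℚ) κ 1 γ - 1)) ∧
            ∃ u : ℤ_[2]ˣ, (Nat.card (endInvariants (conjSignedSelmerInfty ((⟨0, 0, 1, -36440118, -92277007144⟩ : WeierstrassCurve ℤ).baseChange ℚ) κ 1 γ - 1)) : ℚ_[2]) =
              ((u : ℤ_[2]) : ℚ_[2]) * ((2 : ℕ) : ℚ_[2]) ^ (padicValNat 2 ((⟨0, 0, 1, -36440118, -92277007144⟩ : WeierstrassCurve ℤ).baseChange ℚ).tamagawaProduct) *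
                (Nat.card (((⟨0, 0, 1, -36440118, -92277007144⟩ : WeierstrassCurve ℤ).baseChange ℚ).selmerGroupPInfty 2) : ℚ_[2]) *
                  (Nat.card (EndCoinvariants (conjSignedSelmerInfty ((⟨0, 0, 1, -36440118, -92277007144⟩ : WeierstrassCurve ℤ).baseChange ℚ) κ 1 γ - 1)) : ℚ_[2]))
    (hCK : letI := SSColemanRoad.isElliptic_184041bk1
      ∀ (κ : ZpExtension ℚ 2) (γ : Field.absoluteGaloisGroup ℚ),
        κ.IsCyclotomic → κ.IsTopGenerator γ → IsCyclotomicVariable 2 γ →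
        ∀ [NeZero (((⟨0, 0, 1, -36440118, -92277007144⟩ : WeierstrassCurve ℤ).baseChange ℚ).conductorNorm ℤ)] (f : CuspForm (Gamma0 (((⟨0, 0, 1, -36440118, -92277007144⟩ : WeierstrassCurve ℤ).baseChange ℚ).conductorNorm ℤ)) 2),
          IsNewformOf ((⟨0, 0, 1, -36440118, -92277007144⟩ : WeierstrassCurve ℤ).baseChange ℚ) f → ∀ (ϖ : ℚ), (ϖ : ℝ) * ((⟨0, 0, 1, -36440118, -92277007144⟩ : WeierstrassCurve ℤ).baseChange ℚ).realPeriodRat = plusPeriod f →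
        ∀ (Lplus Lminus : IwasawaAlgebra 2), IsPollackPair f 2 Lplus Lminus →
        ∀ (D : SignedSelmerDualData ((⟨0, 0, 1, -36440118, -92277007144⟩ : WeierstrassCurve ℤ).baseChange ℚ) κ γ 1) [ContinuousSMul ℤ_[2] (((⟨0, 0, 1, -36440118, -92277007144⟩ : WeierstrassCurve ℤ).baseChange ℚ).tateModule 2)],
          ∃ (I : Kato2004.IwasawaH1Data ((⟨0, 0, 1, -36440118, -92277007144⟩ : WeierstrassCurve ℤ).baseChange ℚ) 2 κ γ) (Y : ((⟨0, 0, 1, -36440118, -92277007144⟩ : WeierstrassCurve ℤ).baseChange ℚ).FineSelmerDualData κ γ)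
            (P : Submodule (IwasawaAlgebra 2) (IwasawaAlgebra 2))
            (loc : I.H →ₗ[IwasawaAlgebra 2] P) (toX : P →ₗ[IwasawaAlgebra 2] D.X)
            (δ : D.X →ₗ[IwasawaAlgebra 2] Y.X) (Z : Submodule (IwasawaAlgebra 2) I.H)
            (G : IwasawaAlgebra 2),
            Function.Exact loc toX ∧ Function.Exact toX δ ∧
            G ∈ Submodule.map (P.subtype ∘ₗ loc) Z ∧
            iwasawaToPowerSeries 2 G =
              PowerSeries.C (ϖ : ℚ_[2]) * iwasawaToPowerSeries 2 (kobayashiL 1 Lplus Lminus) ∧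
            (∀ 𝔭 : PrimeSpectrum (IwasawaAlgebra 2), 𝔭.asIdeal.height = 1 →
              PowerSeries.C (2 : ℤ_[2]) ∉ 𝔭.asIdeal →
              Literature.NumberTheory.EllipticCurves.Module.lengthAt (IwasawaAlgebra 2) Y.X 𝔭 ≤
                Literature.NumberTheory.EllipticCurves.Module.lengthAt (IwasawaAlgebra 2) (I.H ⧸ Z) 𝔭))
    (hT2A : letI := isElliptic_cmA1089a
      ∀ (κ : ZpExtension ℚ 2) (γ : Field.absoluteGaloisGroup ℚ), κ.IsCyclotomic → κ.IsTopGenerator γ →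
      ∀ D : SignedSelmerDualData ((⟨0, 0, 1, 0, 30⟩ : WeierstrassCurve ℤ).baseChange ℚ) κ γ 1, Module.IsTorsion (IwasawaAlgebra 2) D.X)
    (hmuA : letI := isElliptic_cmA1089a
      ∀ (κ : ZpExtension ℚ 2) (γ : Field.absoluteGaloisGroup ℚ), κ.IsCyclotomic → κ.IsTopGenerator γ →
      ∀ D : SignedSelmerDualData ((⟨0, 0, 1, 0, 30⟩ : WeierstrassCurve ℤ).baseChange ℚ) κ γ 1, D.mu = 0)
    (hKimA : letI := isElliptic_cmA1089a
      ∀ (κ : ZpExtension ℚ 2) (γ : Field.absoluteGaloisGroup ℚ), κ.IsCyclotomic → κ.IsTopGenerator γ →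
      ∀ (D : SignedSelmerDualData ((⟨0, 0, 1, 0, 30⟩ : WeierstrassCurve ℤ).baseChange ℚ) κ γ 1) [Module.Finite (IwasawaAlgebra 2) D.X],
        Module.IsTorsion (IwasawaAlgebra 2) D.X →
      ∀ g : IwasawaAlgebra 2, D.charIdeal = Ideal.span {g} → Finite (((⟨0, 0, 1, 0, 30⟩ : WeierstrassCurve ℤ).baseChange ℚ).selmerGroupPInfty 2) →
        ∃ u : ℤ_[2]ˣ, ((PowerSeries.constantCoeff g : ℤ_[2]) : ℚ_[2]) =
          ((u : ℤ_[2]) : ℚ_[2]) * ((2 : ℕ) : ℚ_[2]) ^ (padicValNat 2 ((⟨0, 0, 1, 0, 30⟩ : WeierstrassCurve ℤ).baseChange ℚ).tamagawaProduct) *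
            (Nat.card (((⟨0, 0, 1, 0, 30⟩ : WeierstrassCurve ℤ).baseChange ℚ).selmerGroupPInfty 2) : ℚ_[2]))
    (hCKA : letI := isElliptic_cmA1089a
      ∀ (κ : ZpExtension ℚ 2) (γ : Field.absoluteGaloisGroup ℚ),
        κ.IsCyclotomic → κ.IsTopGenerator γ → IsCyclotomicVariable 2 γ →
        ∀ [NeZero (((⟨0, 0, 1, 0, 30⟩ : WeierstrassCurve ℤ).baseChange ℚ).conductorNorm ℤ)] (f : CuspForm (Gamma0 (((⟨0, 0, 1, 0, 30⟩ : WeierstrassCurve ℤ).baseChange ℚ).conductorNorm ℤ)) 2),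
          IsNewformOf ((⟨0, 0, 1, 0, 30⟩ : WeierstrassCurve ℤ).baseChange ℚ) f → ∀ (ϖ : ℚ), (ϖ : ℝ) * ((⟨0, 0, 1, 0, 30⟩ : WeierstrassCurve ℤ).baseChange ℚ).realPeriodRat = plusPeriod f →
        ∀ (Lplus Lminus : IwasawaAlgebra 2), IsPollackPair f 2 Lplus Lminus →
        ∀ (D : SignedSelmerDualData ((⟨0, 0, 1, 0, 30⟩ : WeierstrassCurve ℤ).baseChange ℚ) κ γ 1) [ContinuousSMul ℤ_[2] (((⟨0, 0, 1, 0, 30⟩ : WeierstrassCurve ℤ).baseChange ℚ).tateModule 2)],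
          ∃ (I : Kato2004.IwasawaH1Data ((⟨0, 0, 1, 0, 30⟩ : WeierstrassCurve ℤ).baseChange ℚ) 2 κ γ) (Y : ((⟨0, 0, 1, 0, 30⟩ : WeierstrassCurve ℤ).baseChange ℚ).FineSelmerDualData κ γ)
            (P : Submodule (IwasawaAlgebra 2) (IwasawaAlgebra 2))
            (loc : I.H →ₗ[IwasawaAlgebra 2] P) (toX : P →ₗ[IwasawaAlgebra 2] D.X)
            (δ : D.X →ₗ[IwasawaAlgebra 2] Y.X) (Z : Submodule (IwasawaAlgebra 2) I.H)
            (G : IwasawaAlgebra 2),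
            Function.Exact loc toX ∧ Function.Exact toX δ ∧
            G ∈ Submodule.map (P.subtype ∘ₗ loc) Z ∧
            iwasawaToPowerSeries 2 G =
              PowerSeries.C (ϖ : ℚ_[2]) * iwasawaToPowerSeries 2 (kobayashiL 1 Lplus Lminus) ∧
            (∀ 𝔭 : PrimeSpectrum (IwasawaAlgebra 2), 𝔭.asIdeal.height = 1 →
              PowerSeries.C (2 : ℤ_[2]) ∉ 𝔭.asIdeal →
              Literature.NumberTheory.EllipticCurves.Module.lengthAt (IwasawaAlgebra 2) Y.X 𝔭 ≤
                Literature.NumberTheory.EllipticCurves.Module.lengthAt (IwasawaAlgebra 2) (I.H ⧸ Z) 𝔭))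
    (hLA : ((⟨0, 0, 1, 0, 30⟩ : WeierstrassCurve ℤ).baseChange ℚ).entireLFunction 1 ≠ 0) :
    ∀ (W : WeierstrassCurve ℚ) [W.IsElliptic] [W.IsGloballyMinimal],
      W = (⟨0, 0, 1, -36440118, -92277007144⟩ : WeierstrassCurve ℤ).baseChange ℚ → W.entireLFunction 1 ≠ 0 → BSDp W 2 := by
  intro W _ _ hW hL
  subst hW
  haveI := isElliptic_cmA1089a
  haveI := isGloballyMinimal_cmA1089a
  exact bsdp_two_baseChange_int_of_katoBothSides_at _ _ hmod hGZK h124 hX0 hBF h2 hT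
    SSColemanRoad.not_hasCM_184041bk1 hL SSColemanRoad.goodSS_two_184041bk1.2.2 SSColemanRoad.goodSS_two_184041bk1.2.1
    hasCM_cmA1089a hLA goodSS_two_cmA1089a.2.2 goodSS_two_cmA1089a.2.1 _ _
    tschirnhaus_root_184041bk1 tschirnhaus_inv_184041bk1 hEC hCK hT2A hmuA hKimA hCKA

end SSThetaRoad

end Summit.BirchSwinnertonDyer.BirchSwinnertonDyer.Theorems

end
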